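import Mathlib

/-!
# Venture HSemireg — W3 SPECIAL FIBRES: the W-DESCENT for Schoen's carrier at a Ries member — the trade-divisor
# gluing lemma, the label combinatorics of the 2187 components, and the descent bookkeeping (seat `engine-1`
# g16, files of record `engine/engine1/g16/WDESCENT-NOTE-engine1.md`, `WDESCENT-PROOFS-engine1.md`; spec
# `widen/W3/W3-JAC-1-RIES.md` §6.12 (h))

HONEST FRAMING. Lean index of the computation cell `pub-hsemireg`, engine seat `engine-1` («code 0» of the
W-DESCENT).  ELEMENTARY ALGEBRA, FINITE COMBINATORICS AND ARITHMETIC ONLY: no curve, no cover, no symmetric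
product, no sheaf and no cohomology group is constructed here.  On paper (RIES §6.12 (h)) the Ries carrier
`X₀ ⊂ C̃₀^{(8)}` is uniformised by `X̂₀ = X₀ ×_{ℙ⁴} C̃₀⁴`, a union of `2187 = 3⁷` smooth graphs `Γ_λ`
labelled by `λ = (a_i, b_i)_{i<4} ∈ ((ℤ/3)²)⁴` with `Σ (b_i − a_i) ≡ t`, permuted by `W = S₃ ≀ S₄`; along a TRADE
divisor four graphs meet with local ring `{ā² = a² = b²}`, which is NOT seminormal: besides the three value
conditions there is ONE normal-derivative condition `f₁ − f₂ − f₃ + f₄ ∈ I²` (RIES (h)(4)).  This file records: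
(§1) the algebraic LEMMA τ behind «on `W`-invariants the derivative condition follows from the value
condition» — for a ring involution `τ` with `τ t = −t` acting trivially modulo `t`, every `g ∈ (t)` has
`g + τ g ∈ (t²)` (`tau_lemma`); (§2) the degree-one shadow of the trade algebra: the sign vector `(1,−1,−1,1)`
is the product of the two branch-ordering characters and is NOT a combination of `(1,1,1,1)`, `(1,1,−1,−1)`,
`(1,−1,1,−1)` (`trade_missing_direction`, `trade_sign_product`); (§3) the label calculus: `S₃` acts on the nine
labels of a slot preserving the type `s = b − a`, rotations freely, the involution `ι̃σ^u` fixing exactly the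
labels with `a + b = u` (`type_preserved`, `rotations_free`, `stab_involution_iff`), and over a general point of the discriminant
the `81` label pairs of two colliding slots split as `36` TRADE (four readings) + `36` COLLISION (two readings) +
`9` double pairs, for every relative position `γ ∈ S₃` (`local_degree_census`) — RIES (h)(4)'s
`81 = 9·4 + 18·2 + 9·1`; per type-class `27 = 12 + 12 + 3` (`local_degree_census_typed`); (§4) the
arithmetic of the descent: orbit sizes and stabiliser orders (`orbit_bookkeeping`), the `E₁` term
`24 + 72 + 48 + 48 + 48 = 240 = 8·36 − 48` and the double-locus target `4·36 − 48 = 96 = 48 + 48`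
(`e1_bookkeeping`), and the shape of the final reading: `36 ≤ h ≤ K₁` and `K₁ = 36` force `h = 36`, hence
`h − 24 = 12 ≤ 15` (`descent_reading`) — an implication about natural numbers, the value of `K₁` being the
engine's (sealed) output and NOT asserted here.  Nothing here says that HC, HC_CM or HC_AV holds, that any
object is (or is not) semiregular, or that the geometric identifications of the W-DESCENT note are correct;
tiers are the W3 pen's.

CONTENT (all PROVED, 0 sorry), namespace `Summit.Ventures.HSemireg.SchoenCarrierWDescentGluing`.
-/

namespace Summit.Ventures.HSemireg.SchoenCarrierWDescentGluing

section TauLemma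

variable {A : Type*} [CommRing A]

/-- LEMMA τ (WDESCENT-NOTE §3.3 / PROOFS §E), algebraic form.  Let `τ` be a ring endomorphism with
`τ t = -t` which acts trivially modulo `t` (every `a - τ a` is a multiple of `t`; for the reflection in a
trade divisor this holds because `τ` fixes the divisor pointwise).  Then for every `g` in the ideal `(t)`
the symmetrisation `g + τ g` lies in `(t²)`.  On paper: for a `τ`-invariant tuple of branch functions the
value condition `f_λ - f_μ ∈ I_Δ` already gives the normal-derivative condition
`(1 + τ)(f_λ - f_μ) ∈ I_Δ²`. -/
theorem tau_lemma (τ : A →+* A) (t : A) (hτt : τ t = -t)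
    (htriv : ∀ a : A, a - τ a ∈ Ideal.span ({t} : Set A))
    (g : A) (hg : g ∈ Ideal.span ({t} : Set A)) :
    g + τ g ∈ Ideal.span ({t ^ 2} : Set A) := by
  rw [Ideal.mem_span_singleton] at hg
  obtain ⟨g', rfl⟩ := hg
  have h1 : g' - τ g' ∈ Ideal.span ({t} : Set A) := htriv g'
  rw [Ideal.mem_span_singleton] at h1
  obtain ⟨h, hh⟩ := h1
  rw [Ideal.mem_span_singleton]
  refine ⟨h, ?_⟩
  have : t * g' + τ (t * g') = t * (g' - τ g') := by
    rw [map_mul, hτt]; ring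
  rw [this, hh]; ring

/-- The same statement with the roles made explicit for the four branches: if `f₁ = f_λ`, `f₄ = τ f_λ`,
`f₂ = f_μ`, `f₃ = τ f_μ` (the `τ`-invariant tuple) and `f_λ - f_μ ∈ (t)`, then
`f₁ - f₂ - f₃ + f₄ ∈ (t²)`. -/
theorem tau_lemma_four_branches (τ : A →+* A) (t : A) (hτt : τ t = -t)
    (htriv : ∀ a : A, a - τ a ∈ Ideal.span ({t} : Set A))
    (fl fm : A) (hval : fl - fm ∈ Ideal.span ({t} : Set A)) :
    fl - fm - τ fm + τ fl ∈ Ideal.span ({t ^ 2} : Set A) := by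
  have := tau_lemma τ t hτt htriv (fl - fm) hval
  have e : fl - fm - τ fm + τ fl = (fl - fm) + τ (fl - fm) := by
    rw [map_sub]; ring
  rw [e]; exact this

end TauLemma

section TradeAlgebra

/-- RIES (h)(4) / WDESCENT-NOTE §3.1, degree-one shadow of the trade algebra `{ā² = a² = b²}`: in the
product of the four branches the degree-one parts of `a, ā, b` are `(1,1,1,1)`, `(1,1,-1,-1)`, `(1,-1,1,-1)`
(times `a`), and the remaining sign vector `(1,-1,-1,1)` is NOT a rational combination of them — this is the
one missing degree-one direction, i.e. the one normal-derivative condition. -/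
theorem trade_missing_direction :
    ¬ ∃ x y z : ℚ, x + y + z = 1 ∧ x + y - z = -1 ∧ x - y + z = -1 ∧ x - y - z = 1 := by
  rintro ⟨x, y, z, h1, h2, h3, h4⟩
  linarith

/-- … while in degree two it is present: `(1,-1,-1,1) = (1,1,-1,-1) · (1,-1,1,-1)` componentwise (the
product `āb` supplies it), so the conductor of the trade locus has exactly one derivative condition
(conductor Hilbert function `3, 4, 4, 4, …`). -/
theorem trade_sign_product :
    (fun i : Fin 4 => (![1, 1, -1, -1] : Fin 4 → ℤ) i * (![1, -1, 1, -1] : Fin 4 → ℤ) i) =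
      (![1, -1, -1, 1] : Fin 4 → ℤ) := by
  funext i; fin_cases i <;> rfl

end TradeAlgebra

section Labels

/-! ### Label calculus (no definitions: the action is written inline).
An element of `S₃ = ⟨σ, ι̃⟩` is coded as `g : Bool × Fin 3`: `(false, k)` = the rotation `σ^k`, `(true, u)` =
the involution `ι̃σ^u`.  A lift pair through `c` is a label `l = (a, b) : Fin 3 × Fin 3` (the pair
`{σ^a c, ι̃σ^b c}`), of type `s = b − a`.  The action of `g` on the labels of a slot (RIES (h)(2),
`D̃_{wλ} = D̃_λ ∘ w⁻¹`) is `ACT g l := if g.1 then (g.2 − b, g.2 − a) else (a − g.2, b − g.2)`, and reading the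
second slot's label at the first slot's coordinate on the twisted diagonal `c_j = γ c_i` is
`READ γ l := if γ.1 then (γ.2 − b, γ.2 − a) else (a + γ.2, b + γ.2)` (group law `σ^k ι̃ = ι̃ σ^{−k}`). -/

/-- The type `b − a` is preserved by every element of `S₃`. -/
theorem type_preserved : ∀ g : Bool × Fin 3, ∀ l : Fin 3 × Fin 3,
    (if g.1 then ((g.2 - l.2, g.2 - l.1) : Fin 3 × Fin 3) else (l.1 - g.2, l.2 - g.2)).2 -
      (if g.1 then ((g.2 - l.2, g.2 - l.1) : Fin 3 × Fin 3) else (l.1 - g.2, l.2 - g.2)).1 = l.2 - l.1 := by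
  decide

/-- Non-trivial rotations act freely on the nine labels. -/
theorem rotations_free : ∀ k : Fin 3, k ≠ 0 → ∀ l : Fin 3 × Fin 3,
    ((l.1 - k, l.2 - k) : Fin 3 × Fin 3) ≠ l := by decide

/-- The involution `ι̃σ^u` fixes the label `(a, b)` iff `a + b = u`: each label has exactly one stabilising
involution, `ι̃σ^{a+b}` (RIES's `ι̃_{s+2a}`, `s = b − a`). -/
theorem stab_involution_iff : ∀ u : Fin 3, ∀ l : Fin 3 × Fin 3,
    ((u - l.2, u - l.1) : Fin 3 × Fin 3) = l ↔ l.1 + l.2 = u := by decide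

/-- RIES (h)(4)'s local degree census over a general point of the discriminant, for EVERY relative position
`γ ∈ S₃` of the two colliding slots: classify the `81` label pairs `(l₁, l₂)` by how many points the pair `l₁`
shares with the pair `READ γ l₂` (equal rotation index and/or equal involution index): `36` share none
(TRADE / F-block, four readings), `36` share one (COLLISION, two readings), `9` share both (double pair,
one reading) — `81 = 9·4 + 18·2 + 9·1`. -/
theorem local_degree_census : ∀ γ : Bool × Fin 3,
    (Finset.univ.filter (fun p : (Fin 3 × Fin 3) × (Fin 3 × Fin 3) =>
      ((if p.1.1 = (if γ.1 then γ.2 - p.2.2 else p.2.1 + γ.2) then 1 else 0) +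
       (if p.1.2 = (if γ.1 then γ.2 - p.2.1 else p.2.2 + γ.2) then 1 else 0) : ℕ) = 0)).card = 36 ∧
    (Finset.univ.filter (fun p : (Fin 3 × Fin 3) × (Fin 3 × Fin 3) =>
      ((if p.1.1 = (if γ.1 then γ.2 - p.2.2 else p.2.1 + γ.2) then 1 else 0) +
       (if p.1.2 = (if γ.1 then γ.2 - p.2.1 else p.2.2 + γ.2) then 1 else 0) : ℕ) = 1)).card = 36 ∧
    (Finset.univ.filter (fun p : (Fin 3 × Fin 3) × (Fin 3 × Fin 3) =>
      ((if p.1.1 = (if γ.1 then γ.2 - p.2.2 else p.2.1 + γ.2) then 1 else 0) +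
       (if p.1.2 = (if γ.1 then γ.2 - p.2.1 else p.2.2 + γ.2) then 1 else 0) : ℕ) = 2)).card = 9 := by
  decide

/-- The same census inside one type class `(b₁ − a₁) + (b₂ − a₂) = τ` (the constraint `Σ s_i ≡ t` couples the
two colliding slots to the other two): `27 = 12 + 12 + 3` for every `τ` and every `γ`. -/
theorem local_degree_census_typed : ∀ γ : Bool × Fin 3, ∀ τ : Fin 3,
    (Finset.univ.filter (fun p : (Fin 3 × Fin 3) × (Fin 3 × Fin 3) =>
      (p.1.2 - p.1.1) + (p.2.2 - p.2.1) = τ ∧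
      ((if p.1.1 = (if γ.1 then γ.2 - p.2.2 else p.2.1 + γ.2) then 1 else 0) +
       (if p.1.2 = (if γ.1 then γ.2 - p.2.1 else p.2.2 + γ.2) then 1 else 0) : ℕ) = 0)).card = 12 ∧
    (Finset.univ.filter (fun p : (Fin 3 × Fin 3) × (Fin 3 × Fin 3) =>
      (p.1.2 - p.1.1) + (p.2.2 - p.2.1) = τ ∧
      ((if p.1.1 = (if γ.1 then γ.2 - p.2.2 else p.2.1 + γ.2) then 1 else 0) +
       (if p.1.2 = (if γ.1 then γ.2 - p.2.1 else p.2.2 + γ.2) then 1 else 0) : ℕ) = 1)).card = 12 ∧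
    (Finset.univ.filter (fun p : (Fin 3 × Fin 3) × (Fin 3 × Fin 3) =>
      (p.1.2 - p.1.1) + (p.2.2 - p.2.1) = τ ∧
      ((if p.1.1 = (if γ.1 then γ.2 - p.2.2 else p.2.1 + γ.2) then 1 else 0) +
       (if p.1.2 = (if γ.1 then γ.2 - p.2.1 else p.2.2 + γ.2) then 1 else 0) : ℕ) = 2)).card = 3 := by
  decide

/-- In a trade (no shared point) whose given matching has equal types, the OTHER perfect matching of the same
four points has the two other types, distinct from each other — the trade joins a stratum to the ADJACENT
stratum `τ − 2[s] + [s+1] + [s+2]` (the six double loci of RIES THEOREM STRATA).  With `r = READ γ l₂`: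
if `l₁.1 ≠ r.1`, `l₁.2 ≠ r.2` and `type l₁ = type r`, then the cross pairs `(l₁.1, r.2)`, `(r.1, l₁.2)` have
types `≠ type l₁` and `≠` each other. -/
theorem trade_types : ∀ γ : Bool × Fin 3, ∀ l₁ l₂ : Fin 3 × Fin 3,
    l₁.1 ≠ (if γ.1 then γ.2 - l₂.2 else l₂.1 + γ.2) →
    l₁.2 ≠ (if γ.1 then γ.2 - l₂.1 else l₂.2 + γ.2) →
    l₁.2 - l₁.1 = (if γ.1 then γ.2 - l₂.1 else l₂.2 + γ.2) - (if γ.1 then γ.2 - l₂.2 else l₂.1 + γ.2) →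
      (if γ.1 then γ.2 - l₂.1 else l₂.2 + γ.2) - l₁.1 ≠ l₁.2 - l₁.1 ∧
      l₁.2 - (if γ.1 then γ.2 - l₂.2 else l₂.1 + γ.2) ≠ l₁.2 - l₁.1 ∧
      (if γ.1 then γ.2 - l₂.1 else l₂.2 + γ.2) - l₁.1 ≠ l₁.2 - (if γ.1 then γ.2 - l₂.2 else l₂.1 + γ.2) := by
  decide

end Labels

section Bookkeeping

/-- RIES (h)(2): `|Λ_t| = 3⁷ = 2187`, the five `W`-orbits have sizes `81·(1, 12, 6, 4, 4)` (multinomials of the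
compositions `(4,0,0), (2,1,1), (0,2,2), (1,3,0), (1,0,3)`), and `|W| = 6⁴·24 = 31104 = orbit · |Stab|` with
`|Stab| = 16 · ∏ m_s! = 384, 32, 64, 96, 96`. -/
theorem orbit_bookkeeping :
    (3 : ℕ) ^ 7 = 2187 ∧ 81 * (1 + 12 + 6 + 4 + 4) = 2187 ∧ 6 ^ 4 * 24 = 31104 ∧
    81 * 384 = 31104 ∧ 972 * 32 = 31104 ∧ 486 * 64 = 31104 ∧ 324 * 96 = 31104 ∧
    16 * Nat.factorial 4 = 384 ∧ 16 * (Nat.factorial 2 * Nat.factorial 1 * Nat.factorial 1) = 32 ∧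
    16 * (Nat.factorial 2 * Nat.factorial 2) = 64 ∧ 16 * (Nat.factorial 1 * Nat.factorial 3) = 96 := by
  decide

/-- WDESCENT-NOTE §2/§4/§5: per component `H¹(Γ_λ, F̂₀) = 8·36 − 4·12 = 240` in the point model
(`36 = h¹(C̃₀, T)`, twelve (α)-relations per slot), the slot invariants `36 − 12 = 24 = 9 + 15`, the `E₁` term
`24·(1 + 3 + 2 + 2 + 2) = 24 + 72 + 48 + 48 + 48 = 240`, the double-locus block `4·36 − 48 = 96 = 48 + 48`,
and the Schiffer module `36 = 33 + 3` (`36` classes, `3` Vandermonde relations, `3` inert). -/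
theorem e1_bookkeeping :
    8 * 36 - 4 * 12 = 240 ∧ 36 - 12 = 24 ∧ 9 + 15 = 24 ∧ 24 * (1 + 3 + 2 + 2 + 2) = 240 ∧
    24 + 72 + 48 + 48 + 48 = 240 ∧ 4 * 36 - 48 = 96 ∧ 48 + 48 = 96 ∧ 36 - 3 + 3 = 36 ∧
    3 * 12 = 36 := by
  decide

/-- The shape of the final reading (RIES (d) + (h)(6), red-w-1 P-H1-3/4): if the descent gives `h ≤ K₁`, the
curve classes give `36 ≤ h`, and the engine's kernel count is `K₁ = 36`, then `h = 36`, the general-member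
bound is `h − 24 = 12`, and `12 ≤ 15` is the «≤ 15» branch of the verdict rule.  (The hypothesis `K₁ = 36` is
the engine's output; it is NOT asserted in this file.) -/
theorem descent_reading (h K₁ : ℕ) (hlow : 36 ≤ h) (hup : h ≤ K₁) (hK : K₁ = 36) :
    h = 36 ∧ h - 24 = 12 ∧ h - 24 ≤ 15 := by
  subst hK
  have : h = 36 := le_antisymm hup hlow
  subst this
  decide

/-- Calibration arithmetic (RIES (h)(6) (i)–(iii)): `𝒪`: invariants `4·(1+3+2+2+2) = 40`, THEOREM Q's `8 = 2·4`;
`Π*𝒪(1)`: invariant monomial sections `5 + 12 + 9 + 8 + 8 = 42` (`dim Sym^m ℂ² = m + 1` per axis) and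
`5 = h⁰(ℙ⁴, 𝒪(1))`. -/
theorem calibration_bookkeeping :
    4 * (1 + 3 + 2 + 2 + 2) = 40 ∧ 2 * 4 = 8 ∧
    (4 + 1) + (2 + 1) * (1 + 1) * (1 + 1) + (2 + 1) * (2 + 1) + (1 + 1) * (3 + 1) + (1 + 1) * (3 + 1) = 42 ∧
    4 + 1 = 5 := by
  decide

end Bookkeeping

end Summit.Ventures.HSemireg.SchoenCarrierWDescentGluing
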